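import Summits.Ventures.PercRepro.Night2TriangleDisjointArith
import Summits.Ventures.PercRepro.Night2SeriesTriangle
import Summits.Ventures.PercRepro.Night2FourFatCount

/-!
# PercRepro — the TRIANGLE-PLUS-DISJOINT count of the covering bases (night-2, gen 23)

Three hyperplanes missing `{p, x}`, `{p, y}`, `{x, y}` (a triangle of 2-cocircuits) and a fourth missing a pair
`P₃` disjoint from the triangle bound the covering bases of a target by `cntTriD ρ s` (`Night2TriangleDisjointArith`):
**`card_coverBases_le_cntTriD`** — the covering bases lie in `N₃(S′) ∖ N₃(S′ ∩ H₃)` with `N₃` the family of the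
`ρ`-subsets inside none of the triangle's hyperplanes (`card_coverBases_le_card_sdiff_three`), both counted exactly
by the three-set inclusion–exclusion (`card_sdiff_three_powersetCard_add_eq`), the traces through
`Σ_i |S′ ∩ P_i| = 2 |S′ ∩ {p, x, y}|` and the disjointness of `P₃` from the triangle.  At `(3, 0)`: with the
face-sum budget at `n = 11`, `k = 4` (`113/405`) the count sum is `1.062`; with the chord at `n = 12`: `1.097`.
-/

namespace PercRepro.Shadow

open Finset PerFlat ThmH

/-- The linear assembly of the triangle-plus-disjoint count. -/
theorem triD_count_assemble (cb N1 N2 cS b0 b1 b2 y x01 x02 x12 cX bX0 bX1 bX2 yX xX01 xX02 xX12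
    P B0 B1 B2 X0 D0 D1 D2 R C3 C2 C1 C0 CS : ℕ)
    (h1 : cb + N2 ≤ N1) (cs : cS = CS)
    (e1 : N1 + b0 + b1 + b2 + y = cS + x01 + x02 + x12)
    (e2 : N2 + bX0 + bX1 + bX2 + yX = cX + xX01 + xX02 + xX12)
    (u01 : x01 ≤ P) (u02 : x02 ≤ P) (u12 : x12 ≤ P) (ly : P ≤ y)
    (c0 : b0 = B0) (c1 : b1 = B1) (c2 : b2 = B2) (cx : cX = X0)
    (d0 : bX0 ≤ D0) (d1 : bX1 ≤ D1) (d2 : bX2 ≤ D2)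
    (r01 : R ≤ xX01) (r02 : R ≤ xX02) (r12 : R ≤ xX12) (ry : yX ≤ R)
    (h3 : 2 * P + D0 + D1 + D2 + 4 * C3 + 2 * C0 ≤ B0 + B1 + B2 + X0 + 2 * R + 2 * C2 + 3 * C1) :
    cb + 4 * C3 + 2 * C0 ≤ CS + 2 * C2 + 3 * C1 := by
  omega

variable {α : Type*} [DecidableEq α] {M : Matroid α} [M.Finite]

open scoped Classical in
/-- **The triangle-plus-disjoint count**: three rank-`≤ q` sets `H₀, H₁, H₂ ⊇ K` missing `{p, x}`, `{p, y}`, `{x, y}`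
and a fourth `H₃ ⊇ K` missing `≤ 2` points, none of them in the triangle, bound the covering bases of every target
`S ⊆ G` by `cntTriD ρ |S ∖ K|` (`ρ ≥ 4`). -/
theorem card_coverBases_le_cntTriD {q ρ : ℕ} {G : Finset α} (hk : kColoops M G + ρ = q + 1) (hρ : 4 ≤ ρ)
    {H₀ H₁ H₂ H₃ : Finset α} (hK₀ : coloops M G ⊆ H₀) (hH₀ : M.eRk (H₀ : Set α) ≤ (q : ℕ∞))
    (hK₁ : coloops M G ⊆ H₁) (hH₁ : M.eRk (H₁ : Set α) ≤ (q : ℕ∞))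
    (hK₂ : coloops M G ⊆ H₂) (hH₂ : M.eRk (H₂ : Set α) ≤ (q : ℕ∞))
    (hK₃ : coloops M G ⊆ H₃) (hH₃ : M.eRk (H₃ : Set α) ≤ (q : ℕ∞))
    {p x y : α} (hP₀ : G \ H₀ = {p, x}) (hP₁ : G \ H₁ = {p, y}) (hP₂ : G \ H₂ = {x, y})
    (hpx : p ≠ x) (hpy : p ≠ y) (hxy : x ≠ y) (hm₃ : (G \ H₃).card ≤ 2) (hd₃ : (G \ H₃) ∩ {p, x, y} = ∅)
    {S : Finset α} (hSG : S ⊆ G) :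
    ((coverBases M G S ρ).card : ℚ) ≤ cntTriD ρ (S \ coloops M G).card := by
  set S' := S \ coloops M G with hS'
  have hS'G : S' ⊆ G := Finset.sdiff_subset.trans hSG
  have h0 : (coverBases M G S ρ).card ≤ S'.card.choose ρ := card_coverBases_le G S ρ
  by_cases hsmall : S'.card ≤ ρ + 1
  · unfold cntTriD
    rw [Nat.choose_eq_zero_of_lt (by omega : S'.card - 2 < ρ), Nat.choose_eq_zero_of_lt (by omega : S'.card - 3 < ρ),
      Nat.choose_eq_zero_of_lt (by omega : S'.card - 4 < ρ), Nat.choose_eq_zero_of_lt (by omega : S'.card - 5 < ρ)]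
    have h5 := (Nat.cast_le (α := ℚ)).2 h0
    push_cast at h5 ⊢
    linarith
  push Not at hsmall
  obtain ⟨t, rfl⟩ : ∃ t, ρ = t + 3 := ⟨ρ - 3, by omega⟩
  obtain ⟨m, hm⟩ : ∃ m, S'.card = m + 5 := ⟨S'.card - 5, by omega⟩
  -- the missed parts of the target are its traces on the pairs
  have hsd : ∀ {H : Finset α}, S' \ H = S' ∩ (G \ H) := by
    intro H
    ext z
    simp only [Finset.mem_sdiff, Finset.mem_inter]
    exact ⟨fun h => ⟨h.1, hS'G h.1, h.2⟩, fun h => ⟨h.1, h.2.2⟩⟩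
  have ha₀ : (S' \ H₀).card = (S' ∩ {p, x}).card := by rw [hsd, hP₀]
  have ha₁ : (S' \ H₁).card = (S' ∩ {p, y}).card := by rw [hsd, hP₁]
  have ha₂ : (S' \ H₂).card = (S' ∩ {x, y}).card := by rw [hsd, hP₂]
  have hpair := card_inter_pair_add_eq S' hpx hpy hxy
  have hb₀ := Finset.card_sdiff_add_card_inter S' H₀
  have hb₁ := Finset.card_sdiff_add_card_inter S' H₁
  have hb₂ := Finset.card_sdiff_add_card_inter S' H₂
  have hb₃ := Finset.card_sdiff_add_card_inter S' H₃
  have ha₀2 : (S' ∩ {p, x}).card ≤ 2 := (Finset.card_le_card Finset.inter_subset_right).trans Finset.card_le_two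
  have ha₁2 : (S' ∩ {p, y}).card ≤ 2 := (Finset.card_le_card Finset.inter_subset_right).trans Finset.card_le_two
  have ha₂2 : (S' ∩ {x, y}).card ≤ 2 := (Finset.card_le_card Finset.inter_subset_right).trans Finset.card_le_two
  have hu3 : (S' ∩ {p, x, y}).card ≤ 3 :=
    (Finset.card_le_card Finset.inter_subset_right).trans (Finset.card_le_three)
  have ha₃ : (S' \ H₃).card ≤ 2 := (Finset.card_le_card (Finset.sdiff_subset_sdiff hS'G le_rfl)).trans hm₃
  -- the points outside the hyperplanes of the triangle
  have hpH₀ : p ∉ H₀ := by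
    have : p ∈ G \ H₀ := by rw [hP₀]; simp
    exact (Finset.mem_sdiff.1 this).2
  have hxH₀ : x ∉ H₀ := by
    have : x ∈ G \ H₀ := by rw [hP₀]; simp
    exact (Finset.mem_sdiff.1 this).2
  have hpH₁ : p ∉ H₁ := by
    have : p ∈ G \ H₁ := by rw [hP₁]; simp
    exact (Finset.mem_sdiff.1 this).2
  have hyH₁ : y ∉ H₁ := by
    have : y ∈ G \ H₁ := by rw [hP₁]; simp
    exact (Finset.mem_sdiff.1 this).2
  have hxH₂ : x ∉ H₂ := by
    have : x ∈ G \ H₂ := by rw [hP₂]; simp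
    exact (Finset.mem_sdiff.1 this).2
  have hyH₂ : y ∉ H₂ := by
    have : y ∈ G \ H₂ := by rw [hP₂]; simp
    exact (Finset.mem_sdiff.1 this).2
  -- the triangle misses every pairwise intersection
  have htri₀₁ : ∀ z ∈ ({p, x, y} : Finset α), z ∉ H₀ ∩ H₁ := by
    intro z hz
    simp only [Finset.mem_insert, Finset.mem_singleton] at hz
    rw [Finset.mem_inter]
    rcases hz with rfl | rfl | rfl
    · exact fun h => hpH₀ h.1
    · exact fun h => hxH₀ h.1
    · exact fun h => hyH₁ h.2
  have htri₀₂ : ∀ z ∈ ({p, x, y} : Finset α), z ∉ H₀ ∩ H₂ := by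
    intro z hz
    simp only [Finset.mem_insert, Finset.mem_singleton] at hz
    rw [Finset.mem_inter]
    rcases hz with rfl | rfl | rfl
    · exact fun h => hpH₀ h.1
    · exact fun h => hxH₀ h.1
    · exact fun h => hyH₂ h.2
  have htri₁₂ : ∀ z ∈ ({p, x, y} : Finset α), z ∉ H₁ ∩ H₂ := by
    intro z hz
    simp only [Finset.mem_insert, Finset.mem_singleton] at hz
    rw [Finset.mem_inter]
    rcases hz with rfl | rfl | rfl
    · exact fun h => hpH₁ h.1
    · exact fun h => hxH₂ h.2
    · exact fun h => hyH₁ h.1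
  -- a point of the target outside the triangle lies in all three hyperplanes
  have hinall : ∀ z ∈ S', z ∉ ({p, x, y} : Finset α) → z ∈ H₀ ∧ z ∈ H₁ ∧ z ∈ H₂ := by
    intro z hz hzU
    have hzG : z ∈ G := hS'G hz
    refine ⟨?_, ?_, ?_⟩
    · by_contra h
      have : z ∈ G \ H₀ := Finset.mem_sdiff.2 ⟨hzG, h⟩
      rw [hP₀] at this
      apply hzU
      simp only [Finset.mem_insert, Finset.mem_singleton] at this ⊢
      tauto
    · by_contra h
      have : z ∈ G \ H₁ := Finset.mem_sdiff.2 ⟨hzG, h⟩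
      rw [hP₁] at this
      apply hzU
      simp only [Finset.mem_insert, Finset.mem_singleton] at this ⊢
      tauto
    · by_contra h
      have : z ∈ G \ H₂ := Finset.mem_sdiff.2 ⟨hzG, h⟩
      rw [hP₂] at this
      apply hzU
      simp only [Finset.mem_insert, Finset.mem_singleton] at this ⊢
      tauto
  -- the disjoint fourth pair misses the triangle
  have hP₃tri : ∀ z ∈ S' \ H₃, z ∉ ({p, x, y} : Finset α) := by
    intro z hz hzU
    have : z ∈ (G \ H₃) ∩ {p, x, y} :=
      Finset.mem_inter.2 ⟨Finset.mem_sdiff.2 ⟨hS'G (Finset.mem_sdiff.1 hz).1, (Finset.mem_sdiff.1 hz).2⟩, hzU⟩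
    rw [hd₃] at this
    exact Finset.notMem_empty z this
  -- pairwise traces of `S′`: `x_ij + u ≤ s`
  have hpairwise : ∀ {Hi Hj : Finset α}, (∀ z ∈ ({p, x, y} : Finset α), z ∉ Hi ∩ Hj) →
      (S' ∩ Hi ∩ Hj).card + (S' ∩ {p, x, y}).card ≤ S'.card := by
    intro Hi Hj hz
    have hdisj : Disjoint (S' ∩ Hi ∩ Hj) (S' ∩ {p, x, y}) := by
      rw [Finset.disjoint_left]
      intro z hz1 hz2
      rw [Finset.mem_inter] at hz2
      exact hz z hz2.2 (Finset.mem_inter.2 ⟨(Finset.mem_inter.1 (Finset.mem_inter.1 hz1).1).2, (Finset.mem_inter.1 hz1).2⟩)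
    rw [← Finset.card_union_of_disjoint hdisj]
    apply Finset.card_le_card
    apply Finset.union_subset
    · exact Finset.inter_subset_left.trans Finset.inter_subset_left
    · exact Finset.inter_subset_left
  have hx₀₁ := hpairwise htri₀₁
  have hx₀₂ := hpairwise htri₀₂
  have hx₁₂ := hpairwise htri₁₂
  -- the triple trace of `S′`: `y + u ≥ s`
  have hy : S'.card ≤ (S' ∩ H₀ ∩ H₁ ∩ H₂).card + (S' ∩ {p, x, y}).card := by
    have hsub : S' ⊆ (S' ∩ H₀ ∩ H₁ ∩ H₂) ∪ (S' ∩ {p, x, y}) := by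
      intro z hz
      rw [Finset.mem_union]
      by_cases hzU : z ∈ ({p, x, y} : Finset α)
      · exact Or.inr (Finset.mem_inter.2 ⟨hz, hzU⟩)
      · obtain ⟨h0', h1', h2'⟩ := hinall z hz hzU
        exact Or.inl (Finset.mem_inter.2 ⟨Finset.mem_inter.2 ⟨Finset.mem_inter.2 ⟨hz, h0'⟩, h1'⟩, h2'⟩)
    exact (Finset.card_le_card hsub).trans (Finset.card_union_le _ _)
  -- the traces of `X = S′ ∩ H₃`
  have hX₀ : (S' ∩ H₃ ∩ H₀).card + (S' \ H₃).card + (S' \ H₀).card ≤ S'.card := by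
    have := card_inter_inter_le (H₀ := H₃) (H₁ := H₀) hS'G
    have he : (G \ H₃) ∩ (G \ H₀) = ∅ := by
      rw [hP₀]
      apply Finset.eq_empty_of_forall_notMem
      intro z hz
      rw [Finset.mem_inter] at hz
      have : z ∈ (G \ H₃) ∩ {p, x, y} := Finset.mem_inter.2 ⟨hz.1, by
        simp only [Finset.mem_insert, Finset.mem_singleton] at hz ⊢; tauto⟩
      rw [hd₃] at this
      exact Finset.notMem_empty z this
    rw [he, Finset.card_empty] at this
    omega
  have hX₁ : (S' ∩ H₃ ∩ H₁).card + (S' \ H₃).card + (S' \ H₁).card ≤ S'.card := by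
    have := card_inter_inter_le (H₀ := H₃) (H₁ := H₁) hS'G
    have he : (G \ H₃) ∩ (G \ H₁) = ∅ := by
      rw [hP₁]
      apply Finset.eq_empty_of_forall_notMem
      intro z hz
      rw [Finset.mem_inter] at hz
      have : z ∈ (G \ H₃) ∩ {p, x, y} := Finset.mem_inter.2 ⟨hz.1, by
        simp only [Finset.mem_insert, Finset.mem_singleton] at hz ⊢; tauto⟩
      rw [hd₃] at this
      exact Finset.notMem_empty z this
    rw [he, Finset.card_empty] at this
    omega
  have hX₂ : (S' ∩ H₃ ∩ H₂).card + (S' \ H₃).card + (S' \ H₂).card ≤ S'.card := by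
    have := card_inter_inter_le (H₀ := H₃) (H₁ := H₂) hS'G
    have he : (G \ H₃) ∩ (G \ H₂) = ∅ := by
      rw [hP₂]
      apply Finset.eq_empty_of_forall_notMem
      intro z hz
      rw [Finset.mem_inter] at hz
      have : z ∈ (G \ H₃) ∩ {p, x, y} := Finset.mem_inter.2 ⟨hz.1, by
        simp only [Finset.mem_insert, Finset.mem_singleton] at hz ⊢; tauto⟩
      rw [hd₃] at this
      exact Finset.notMem_empty z this
    rw [he, Finset.card_empty] at this
    omega
  -- pairwise traces of `X`: `xX_ij + a₃ + u ≥ s`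
  have hXpair : ∀ {Hi Hj : Finset α}, (∀ z ∈ S', z ∉ ({p, x, y} : Finset α) → z ∈ Hi ∧ z ∈ Hj) →
      S'.card ≤ (S' ∩ H₃ ∩ Hi ∩ Hj).card + (S' \ H₃).card + (S' ∩ {p, x, y}).card := by
    intro Hi Hj hin
    have hsub : S' ⊆ (S' ∩ H₃ ∩ Hi ∩ Hj) ∪ (S' \ H₃) ∪ (S' ∩ {p, x, y}) := by
      intro z hz
      rw [Finset.mem_union, Finset.mem_union]
      by_cases hzU : z ∈ ({p, x, y} : Finset α)
      · exact Or.inr (Finset.mem_inter.2 ⟨hz, hzU⟩)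
      by_cases hz3 : z ∈ H₃
      · obtain ⟨hi, hj⟩ := hin z hz hzU
        exact Or.inl (Or.inl (Finset.mem_inter.2 ⟨Finset.mem_inter.2 ⟨Finset.mem_inter.2 ⟨hz, hz3⟩, hi⟩, hj⟩))
      · exact Or.inl (Or.inr (Finset.mem_sdiff.2 ⟨hz, hz3⟩))
    have h1 := Finset.card_le_card hsub
    have h2 := Finset.card_union_le ((S' ∩ H₃ ∩ Hi ∩ Hj) ∪ (S' \ H₃)) (S' ∩ {p, x, y})
    have h3 := Finset.card_union_le (S' ∩ H₃ ∩ Hi ∩ Hj) (S' \ H₃)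
    omega
  have hX₀₁ := hXpair (Hi := H₀) (Hj := H₁) (fun z hz hzU => ⟨(hinall z hz hzU).1, (hinall z hz hzU).2.1⟩)
  have hX₀₂ := hXpair (Hi := H₀) (Hj := H₂) (fun z hz hzU => ⟨(hinall z hz hzU).1, (hinall z hz hzU).2.2⟩)
  have hX₁₂ := hXpair (Hi := H₁) (Hj := H₂) (fun z hz hzU => ⟨(hinall z hz hzU).2.1, (hinall z hz hzU).2.2⟩)
  -- the triple trace of `X`: `yX + a₃ + u ≤ s`
  have hXy : (S' ∩ H₃ ∩ H₀ ∩ H₁ ∩ H₂).card + (S' \ H₃).card + (S' ∩ {p, x, y}).card ≤ S'.card := by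
    have hd1 : Disjoint (S' ∩ H₃ ∩ H₀ ∩ H₁ ∩ H₂) (S' \ H₃) := by
      rw [Finset.disjoint_left]
      intro z hz hz'
      exact (Finset.mem_sdiff.1 hz').2 (Finset.mem_inter.1 (Finset.mem_inter.1 (Finset.mem_inter.1
        (Finset.mem_inter.1 hz).1).1).1).2
    have hd2 : Disjoint ((S' ∩ H₃ ∩ H₀ ∩ H₁ ∩ H₂) ∪ (S' \ H₃)) (S' ∩ {p, x, y}) := by
      rw [Finset.disjoint_union_left]
      constructor
      · rw [Finset.disjoint_left]
        intro z hz hz'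
        have hzU := (Finset.mem_inter.1 hz').2
        have hz01 : z ∈ H₀ ∩ H₁ :=
          Finset.mem_inter.2 ⟨(Finset.mem_inter.1 (Finset.mem_inter.1 (Finset.mem_inter.1 hz).1).1).2,
            (Finset.mem_inter.1 (Finset.mem_inter.1 hz).1).2⟩
        exact htri₀₁ z hzU hz01
      · rw [Finset.disjoint_left]
        intro z hz hz'
        exact hP₃tri z hz (Finset.mem_inter.1 hz').2
    have hsub : (S' ∩ H₃ ∩ H₀ ∩ H₁ ∩ H₂) ∪ (S' \ H₃) ∪ (S' ∩ {p, x, y}) ⊆ S' := by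
      apply Finset.union_subset
      · apply Finset.union_subset
        · exact Finset.inter_subset_left.trans (Finset.inter_subset_left.trans
            (Finset.inter_subset_left.trans Finset.inter_subset_left))
        · exact Finset.sdiff_subset
      · exact Finset.inter_subset_left
    have := Finset.card_le_card hsub
    rw [Finset.card_union_of_disjoint hd2, Finset.card_union_of_disjoint hd1] at this
    exact this
  -- the variables of the binomial inequality
  obtain ⟨c₀, hc₀⟩ : ∃ c₀, (S' ∩ {p, x}).card + c₀ = 3 :=
    ⟨3 - (S' ∩ {p, x}).card, Nat.add_sub_cancel' (ha₀2.trans (by norm_num))⟩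
  obtain ⟨c₁, hc₁⟩ : ∃ c₁, (S' ∩ {p, y}).card + c₁ = 3 :=
    ⟨3 - (S' ∩ {p, y}).card, Nat.add_sub_cancel' (ha₁2.trans (by norm_num))⟩
  obtain ⟨c₂, hc₂⟩ : ∃ c₂, (S' ∩ {x, y}).card + c₂ = 3 :=
    ⟨3 - (S' ∩ {x, y}).card, Nat.add_sub_cancel' (ha₂2.trans (by norm_num))⟩
  obtain ⟨pp, hpp⟩ : ∃ pp, (S' ∩ {p, x, y}).card + pp = 3 := ⟨3 - (S' ∩ {p, x, y}).card, Nat.add_sub_cancel' hu3⟩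
  obtain ⟨q₃, hq₃⟩ : ∃ q₃, (S' \ H₃).card + q₃ = 2 := ⟨2 - (S' \ H₃).card, Nat.add_sub_cancel' ha₃⟩
  have k₀ : 1 ≤ c₀ := by omega
  have k₀' : c₀ ≤ 3 := by omega
  have k₁ : 1 ≤ c₁ := by omega
  have k₁' : c₁ ≤ 3 := by omega
  have k₂ : 1 ≤ c₂ := by omega
  have k₂' : c₂ ≤ 3 := by omega
  have kp : pp ≤ 3 := by omega
  have kq : q₃ ≤ 2 := by omega
  have ksum : c₀ + c₁ + c₂ = 3 + 2 * pp := by omega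
  have hcb₀ : (S' ∩ H₀).card = m + 2 + c₀ := by omega
  have hcb₁ : (S' ∩ H₁).card = m + 2 + c₁ := by omega
  have hcb₂ : (S' ∩ H₂).card = m + 2 + c₂ := by omega
  have hcX : (S' ∩ H₃).card = m + 3 + q₃ := by omega
  have hsx : (S' ∩ H₀ ∩ H₁).card ≤ m + 2 + pp ∧ (S' ∩ H₀ ∩ H₂).card ≤ m + 2 + pp ∧
      (S' ∩ H₁ ∩ H₂).card ≤ m + 2 + pp ∧ m + 2 + pp ≤ (S' ∩ H₀ ∩ H₁ ∩ H₂).card := by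
    clear hb₀ hb₁ hb₂ hb₃ hcb₀ hcb₁ hcb₂ hcX hX₀ hX₁ hX₂ hX₀₁ hX₀₂ hX₁₂ hXy hpair ha₀ ha₁ ha₂ hc₀ hc₁ hc₂
    omega
  obtain ⟨s₀₁, s₀₂, s₁₂, sy⟩ := hsx
  have hsX : (S' ∩ H₃ ∩ H₀).card ≤ m + q₃ + c₀ ∧ (S' ∩ H₃ ∩ H₁).card ≤ m + q₃ + c₁ ∧
      (S' ∩ H₃ ∩ H₂).card ≤ m + q₃ + c₂ ∧ m + q₃ + pp ≤ (S' ∩ H₃ ∩ H₀ ∩ H₁).card ∧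
      m + q₃ + pp ≤ (S' ∩ H₃ ∩ H₀ ∩ H₂).card ∧ m + q₃ + pp ≤ (S' ∩ H₃ ∩ H₁ ∩ H₂).card ∧
      (S' ∩ H₃ ∩ H₀ ∩ H₁ ∩ H₂).card ≤ m + q₃ + pp := by
    clear hb₀ hb₁ hb₂ hcb₀ hcb₁ hcb₂ hcX hx₀₁ hx₀₂ hx₁₂ hy s₀₁ s₀₂ s₁₂ sy hpair
    omega
  obtain ⟨t₀, t₁, t₂, r₀₁, r₀₂, r₁₂, ry⟩ := hsX
  have u₀₁ := Nat.choose_le_choose (t + 3) s₀₁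
  have u₀₂ := Nat.choose_le_choose (t + 3) s₀₂
  have u₁₂ := Nat.choose_le_choose (t + 3) s₁₂
  have ly := Nat.choose_le_choose (t + 3) sy
  have d₀ := Nat.choose_le_choose (t + 3) t₀
  have d₁ := Nat.choose_le_choose (t + 3) t₁
  have d₂ := Nat.choose_le_choose (t + 3) t₂
  have l₀₁ := Nat.choose_le_choose (t + 3) r₀₁
  have l₀₂ := Nat.choose_le_choose (t + 3) r₀₂
  have l₁₂ := Nat.choose_le_choose (t + 3) r₁₂
  have ly' := Nat.choose_le_choose (t + 3) ry
  have e₀ : (S' ∩ H₀).card.choose (t + 3) = (m + 2 + c₀).choose (t + 3) := by rw [hcb₀]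
  have e₁ : (S' ∩ H₁).card.choose (t + 3) = (m + 2 + c₁).choose (t + 3) := by rw [hcb₁]
  have e₂ : (S' ∩ H₂).card.choose (t + 3) = (m + 2 + c₂).choose (t + 3) := by rw [hcb₂]
  have eX : (S' ∩ H₃).card.choose (t + 3) = (m + 3 + q₃).choose (t + 3) := by rw [hcX]
  have es : S'.card.choose (t + 3) = (m + 5).choose (t + 3) := by rw [hm]
  have h3 := choose_triD_le t m c₀ c₁ c₂ pp q₃ k₀ k₀' k₁ k₁' k₂ k₂' kp kq ksum
  have h1 := card_coverBases_le_card_sdiff_three hk hK₀ hH₀ hK₁ hH₁ hK₂ hH₂ hK₃ hH₃ S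
  rw [← hS'] at h1
  have e1 := card_sdiff_three_powersetCard_add_eq (t + 3) S' H₀ H₁ H₂
  have e2 := card_sdiff_three_powersetCard_add_eq (t + 3) (S' ∩ H₃) H₀ H₁ H₂
  generalize hN1 : (S'.powersetCard (t + 3) \ ((S' ∩ H₀).powersetCard (t + 3) ∪
    (S' ∩ H₁).powersetCard (t + 3) ∪ (S' ∩ H₂).powersetCard (t + 3))).card = N1 at h1 e1
  generalize hN2 : ((S' ∩ H₃).powersetCard (t + 3) \ (((S' ∩ H₃) ∩ H₀).powersetCard (t + 3) ∪
    ((S' ∩ H₃) ∩ H₁).powersetCard (t + 3) ∪ ((S' ∩ H₃) ∩ H₂).powersetCard (t + 3))).card = N2 at h1 e2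
  generalize hcbg : (coverBases M G S (t + 3)).card = cb at h1 ⊢
  have h4 : cb + 4 * (m + 3).choose (t + 3) + 2 * m.choose (t + 3) ≤
      (m + 5).choose (t + 3) + 2 * (m + 2).choose (t + 3) + 3 * (m + 1).choose (t + 3) :=
    triD_count_assemble _ _ _ _ _ _ _ _ _ _ _ _ _ _ _ _ _ _ _ _ _ _ _ _ _ _ _ _ _ _ _ _ _
      h1 es e1 e2 u₀₁ u₀₂ u₁₂ ly e₀ e₁ e₂ eX d₀ d₁ d₂ l₀₁ l₀₂ l₁₂ ly' h3
  unfold cntTriD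
  rw [hm, show m + 5 - 2 = m + 3 from rfl, show m + 5 - 3 = m + 2 from rfl, show m + 5 - 4 = m + 1 from rfl,
    show m + 5 - 5 = m from rfl]
  have h5 := (Nat.cast_le (α := ℚ)).2 h4
  push_cast at h5
  linarith only [h5]

end PercRepro.Shadow
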